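import Summits.KontsevichZagierPeriods.KontsevichZagierPeriods.Theorems.HurwitzMicroSectorsNormalFormPrincipleLevelOne
import Summits.KontsevichZagierPeriods.KontsevichZagierPeriods.Theorems.HurwitzMicroSectorsNormalFormPrincipleSlabASubPtK20
import Summits.KontsevichZagierPeriods.KontsevichZagierPeriods.Theorems.HurwitzMicroSectorsNormalFormPrincipleAlgCarriers
import Summits.KontsevichZagierPeriods.KontsevichZagierPeriods.Theorems.HurwitzMicroSectorsNormalFormPrincipleM2FiveZetaTwo
import Summits.KontsevichZagierPeriods.KontsevichZagierPeriods.Theorems.AperySectorThreeTwo.Negative.Kit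
import Summits.KontsevichZagierPeriods.KontsevichZagierPeriods.Theorems.HurwitzMicroSectorsNormalFormPrincipleLevelKExistsReps

/-!
# `NormalFormPrinciple` (stmt-KontsevichZagierPeriods-3869), line `SketchIdeator1` — leaf `stub_boxRigidity`:
# weight three, level `K`, totally off resonance: the nested band rep and the base rep exist

Registered sub-goal `exists_reps3_nested_base` of the layer `Weight3` (weight three, level `K ≥ 1`,
totally off resonance: the boxes `[(0,1)³, c·x^A y^B z^D/(1 − x^K y^K z^K)]` with pairwise distinct
exponents). For a real algebraic coefficient `c` (`IsAlgebraic ℚ c`) the two shapes of honest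
Kontsevich–Zagier integral representations met at the end of the weight-three pipeline exist,
with LITERAL domains and integrands:

* the NESTED band `N = {0 < z₀ < 1, 0 ≤ z₁ ≤ z₀, z₁/z₀ ≤ z₂ ≤ 1}` (a band over the level-`K`
  triangle `T = {0 < w₀ < 1, 0 ≤ w₁ ≤ w₀}` with edges `w₁/w₀` and `1`) carrying
  `c·z₀^{A'} z₂^{B'} z₁^D/(1 − z₁^K)` — the re-banded merge of the box (rule 2): the domain is
  `ℚ`-semialgebraic (`KZlog.isSemialgebraic_band`, the lower edge `w₁/w₀` a quotient of
  `ℚ`-polynomials on `T`, where `w₀ > 0`), the integrand is the algebraic constant `c` times a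
  quotient of `ℚ`-polynomials whose denominator `1 − z₁^K ≥ 1 − z₁ > 0` does not vanish on `N`;
  absolute convergence by Tonelli along the last coordinate (`integrableOn_band_of_norm_le`): on
  the fibre over `w ∈ T` the integrand is bounded by `|c|/(1 − w₁^K)` and the fibre has length
  `1 − w₁/w₀ ≤ 1 − w₁ ≤ 1 − w₁^K` (as `w₀ ≤ 1` and `w₁^K ≤ w₁`), so the fibre integrals are
  bounded by the constant `|c|`, integrable on `T ⊆ [0,1]²`;
* the BASE representation on the level-`K` triangle `T` carrying
  `(c/E)·(w₀^{A'} w₁^D − w₀^{A'−E} w₁^{D+E})/(1 − w₁^K)` (`E ≤ A'`; for `E = 0` the constant `c/0`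
  is `0`) — the result of integrating out `z₂` over `[z₁/z₀, 1]` (rule 3): the algebraic constant
  `c/E` times a quotient of `ℚ`-polynomials with denominator `1 − w₁^K > 0` on `T`; absolutely
  convergent because it is BOUNDED on `T`: `w₀^{A'} w₁^D − w₀^{A'−E} w₁^{D+E} =
  w₀^{A'−E} w₁^D (w₀^E − w₁^E)` with `0 ≤ w₀^E − w₁^E ≤ 1 − w₁^E ≤ E(1 − w₁) ≤ E(1 − w₁^K)`
  (Bernoulli), whence `|integrand| ≤ |c/E|·E` on a set of finite measure.

References: M. Kontsevich, D. Zagier, *Periods* (2001), §1.1–1.2. No new definitions.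
-/

noncomputable section

open MeasureTheory Set
open Literature.NumberTheory.Transcendental Literature.NumberTheory.Transcendental.KZ
open Literature.ModelTheory.ExponentialFields (IsSemialgebraic)

namespace Summit.KontsevichZagierPeriods.HurwitzMicroSectors.NormalFormPrinciple.PiBox.Weight3

/-! ## The nested band over the level-`K` triangle -/

/-- The level-`K` triangle `T = {0 < w₀ < 1, 0 ≤ w₁ ≤ w₀} ⊆ ℝ²` lies in the closed unit square and
has finite Lebesgue measure. [folklore] -/
theorem w3_volume_triangle_ne_top :
    volume (KZlog.band {y : Fin 1 → ℝ | 0 < y 0 ∧ y 0 < 1} (fun _ => (0:ℝ)) (fun y => y 0)) ≠ ⊤ := by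
  have hsub : KZlog.band {y : Fin 1 → ℝ | 0 < y 0 ∧ y 0 < 1} (fun _ => (0:ℝ)) (fun y => y 0) ⊆
      Set.Icc 0 1 := by
    intro w hw
    have h : (0 < w 0 ∧ w 0 < 1) ∧ 0 ≤ w 1 ∧ w 1 ≤ w 0 := hw
    refine ⟨fun i => ?_, fun i => ?_⟩
    · fin_cases i
      · exact h.1.1.le
      · exact h.2.1
    · fin_cases i
      · exact h.1.2.le
      · exact h.2.2.trans h.1.2.le
  exact ((measure_mono hsub).trans_lt measure_Icc_lt_top).ne

/-- **The nested band is `ℚ`-semialgebraic.** `N = {0 < z₀ < 1, 0 ≤ z₁ ≤ z₀, z₁/z₀ ≤ z₂ ≤ 1}` is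
the band over the (semialgebraic) level-`K` triangle with lower edge the quotient of
`ℚ`-polynomials `w ↦ w₁/w₀` (`w₀ > 0` there) and upper edge the constant `1`
(Tarski–Seidenberg, `KZlog.isSemialgebraic_band`). [cite: KontsevichZagier2001, §1.1] -/
theorem w3_isSemialgebraic_nestedBand :
    IsSemialgebraic ℚ (KZlog.band
      (KZlog.band {y : Fin 1 → ℝ | 0 < y 0 ∧ y 0 < 1} (fun _ => (0:ℝ)) (fun y => y 0))
      (fun w => w 1 / w 0) (fun _ => (1:ℝ))) := by
  have hT := LevelOne.isSemialgebraic_triangleBand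
  refine KZlog.isSemialgebraic_band ?_ ((isSemialgebraicFunOn_aeval hT 1).congr fun w _ => by simp)
  refine (isSemialgebraicFunOn_aeval_div_aeval hT (MvPolynomial.X 1) (MvPolynomial.X 0)
    fun w hw => ?_).congr fun w _ => by simp
  have h : (0 < w 0 ∧ w 0 < 1) ∧ 0 ≤ w 1 ∧ w 1 ≤ w 0 := hw
  simp only [MvPolynomial.aeval_X]
  exact h.1.1.ne'

/-- On the nested band `N = {0 < z₀ < 1, 0 ≤ z₁ ≤ z₀, z₁/z₀ ≤ z₂ ≤ 1}` the level-`K` denominator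
(`K ≥ 1`) is positive, `0 < 1 − z₁^K` (as `0 ≤ z₁ ≤ z₀ < 1`), and the monomial
`z₀^{A'} z₂^{B'} z₁^D` lies in `[0, 1]` (all coordinates lie in `[0, 1]`, `z₂ ≥ z₁/z₀ ≥ 0`).
[folklore] -/
theorem w3_nested_bounds {K : ℕ} (hK : 0 < K) (A' B' D : ℕ) {z : Fin 3 → ℝ}
    (hz : z ∈ KZlog.band
      (KZlog.band {y : Fin 1 → ℝ | 0 < y 0 ∧ y 0 < 1} (fun _ => (0:ℝ)) (fun y => y 0))
      (fun w => w 1 / w 0) (fun _ => (1:ℝ))) :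
    0 < 1 - z 1 ^ K ∧ 0 ≤ z 0 ^ A' * z 2 ^ B' * z 1 ^ D ∧ z 0 ^ A' * z 2 ^ B' * z 1 ^ D ≤ 1 := by
  have h : ((0 < z 0 ∧ z 0 < 1) ∧ 0 ≤ z 1 ∧ z 1 ≤ z 0) ∧ z 1 / z 0 ≤ z 2 ∧ z 2 ≤ 1 := hz
  have h0 : 0 ≤ z 0 := h.1.1.1.le
  have h1 : 0 ≤ z 1 := h.1.2.1
  have h1' : z 1 < 1 := h.1.2.2.trans_lt h.1.1.2
  have h2 : 0 ≤ z 2 := (div_nonneg h1 h0).trans h.2.1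
  refine ⟨sub_pos.2 (pow_lt_one₀ h1 h1' hK.ne'),
    mul_nonneg (mul_nonneg (pow_nonneg h0 _) (pow_nonneg h2 _)) (pow_nonneg h1 _), ?_⟩
  exact mul_le_one₀ (mul_le_one₀ (pow_le_one₀ h0 h.1.1.2.le) (pow_nonneg h2 _)
    (pow_le_one₀ h2 h.2.2)) (pow_nonneg h1 _) (pow_le_one₀ h1 h1'.le)

/-- **Semialgebraicity of the nested-band integrand with an algebraic coefficient.**
`z ↦ c·z₀^{A'} z₂^{B'} z₁^D/(1 − z₁^K)` (`K ≥ 1`) is `ℚ`-semialgebraic on the nested band for real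
algebraic `c`: the algebraic constant `c` (`isSemialgebraicFunOn_const_of_isAlgebraic`) times a
quotient of `ℚ`-polynomials whose denominator `1 − z₁^K` is positive there.
[cite: KontsevichZagier2001, §1.1] -/
theorem w3_isSemialgebraicFunOn_nestedIntegrand {K : ℕ} (hK : 0 < K) (A' B' D : ℕ) {c : ℝ}
    (hc : IsAlgebraic ℚ c) :
    IsSemialgebraicFunOn ℚ (KZlog.band
      (KZlog.band {y : Fin 1 → ℝ | 0 < y 0 ∧ y 0 < 1} (fun _ => (0:ℝ)) (fun y => y 0))
      (fun w => w 1 / w 0) (fun _ => (1:ℝ)))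
      (fun z => c * (z 0 ^ A' * z 2 ^ B' * z 1 ^ D) / (1 - z 1 ^ K)) := by
  have hN := w3_isSemialgebraic_nestedBand
  refine (IsSemialgebraicFunOn.mul_holds (isSemialgebraicFunOn_const_of_isAlgebraic hN hc)
    (isSemialgebraicFunOn_aeval_div_aeval hN
      (MvPolynomial.X 0 ^ A' * MvPolynomial.X 2 ^ B' * MvPolynomial.X 1 ^ D)
      (1 - MvPolynomial.X 1 ^ K) fun z hz => ?_)).congr fun z _ => ?_
  · have h := (w3_nested_bounds hK A' B' D hz).1
    simp only [map_sub, map_one, map_pow, MvPolynomial.aeval_X]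
    exact h.ne'
  · simp only [Pi.mul_apply, map_sub, map_one, map_mul, map_pow, MvPolynomial.aeval_X]
    ring

/-- On the nested band the integrand `c·z₀^{A'} z₂^{B'} z₁^D/(1 − z₁^K)` (`K ≥ 1`) is bounded in
absolute value by `|c|/(1 − z₁^K)` (the monomial lies in `[0, 1]`). [folklore] -/
theorem w3_norm_nestedIntegrand_le {K : ℕ} (hK : 0 < K) (A' B' D : ℕ) (c : ℝ) {z : Fin 3 → ℝ}
    (hz : z ∈ KZlog.band
      (KZlog.band {y : Fin 1 → ℝ | 0 < y 0 ∧ y 0 < 1} (fun _ => (0:ℝ)) (fun y => y 0))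
      (fun w => w 1 / w 0) (fun _ => (1:ℝ))) :
    ‖c * (z 0 ^ A' * z 2 ^ B' * z 1 ^ D) / (1 - z 1 ^ K)‖ ≤ |c| / (1 - z 1 ^ K) := by
  have hb := w3_nested_bounds hK A' B' D hz
  rw [Real.norm_eq_abs, abs_div, abs_mul, abs_of_pos hb.1, abs_of_nonneg hb.2.1]
  exact div_le_div_of_nonneg_right (mul_le_of_le_one_right (abs_nonneg c) hb.2.2) hb.1.le

/-- **Absolute convergence of the nested-band integrand with a real coefficient** (`K ≥ 1`):
`c·z₀^{A'} z₂^{B'} z₁^D/(1 − z₁^K)` is integrable on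
`N = {0 < z₀ < 1, 0 ≤ z₁ ≤ z₀, z₁/z₀ ≤ z₂ ≤ 1}`, by Tonelli along the last coordinate
(`integrableOn_band_of_norm_le`): over `w ∈ T` the fibre `[w₁/w₀, 1]` has length
`1 − w₁/w₀ ≤ 1 − w₁ ≤ 1 − w₁^K` and the integrand is bounded there by `|c|/(1 − w₁^K)`, so the
fibre integrals are bounded by the constant `|c|`, integrable on the triangle `T ⊆ [0,1]²`.
[cite: KontsevichZagier2001, §1.2 rule (2)] -/
theorem w3_integrableOn_nestedIntegrand {K : ℕ} (hK : 0 < K) (A' B' D : ℕ) (c : ℝ) :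
    IntegrableOn (fun z : Fin 3 → ℝ => c * (z 0 ^ A' * z 2 ^ B' * z 1 ^ D) / (1 - z 1 ^ K))
      (KZlog.band
        (KZlog.band {y : Fin 1 → ℝ | 0 < y 0 ∧ y 0 < 1} (fun _ => (0:ℝ)) (fun y => y 0))
        (fun w => w 1 / w 0) (fun _ => (1:ℝ))) := by
  have hTm : MeasurableSet
      (KZlog.band {y : Fin 1 → ℝ | 0 < y 0 ∧ y 0 < 1} (fun _ => (0:ℝ)) (fun y => y 0)) :=
    IsSemialgebraic.measurableSet_holds LevelOne.isSemialgebraic_triangleBand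
  have hNm : MeasurableSet (KZlog.band
      (KZlog.band {y : Fin 1 → ℝ | 0 < y 0 ∧ y 0 < 1} (fun _ => (0:ℝ)) (fun y => y 0))
      (fun w => w 1 / w 0) (fun _ => (1:ℝ))) :=
    IsSemialgebraic.measurableSet_holds w3_isSemialgebraic_nestedBand
  refine integrableOn_band_of_norm_le hTm (M := fun w => |c| / (1 - w 1 ^ K)) (K := fun _ => |c|)
    (fun w hw => ?_) hNm (fun w t => KZlog.snoc_mem_band)
    (Measurable.aestronglyMeasurable (by fun_prop))
    (fun w hw t ht => w3_norm_nestedIntegrand_le hK A' B' D c (KZlog.snoc_mem_band.2 ⟨hw, ht⟩))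
    (fun w hw => ?_) (integrableOn_const w3_volume_triangle_ne_top)
  · have h : (0 < w 0 ∧ w 0 < 1) ∧ 0 ≤ w 1 ∧ w 1 ≤ w 0 := hw
    exact (div_le_one h.1.1).2 h.2.2
  · have h : (0 < w 0 ∧ w 0 < 1) ∧ 0 ≤ w 1 ∧ w 1 ≤ w 0 := hw
    have hpos := (LevelK.lk_triangle_denominator_bounds hK hw)
    have hD : 0 < 1 - w 1 ^ K := hpos.1.trans_le hpos.2
    have hle : 1 - w 1 / w 0 ≤ 1 - w 1 ^ K := by
      have h1 : w 1 ≤ w 1 / w 0 := le_div_self h.2.1 h.1.1 h.1.2.le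
      linarith [hpos.2]
    calc |c| / (1 - w 1 ^ K) * ((1:ℝ) - w 1 / w 0)
        ≤ |c| / (1 - w 1 ^ K) * (1 - w 1 ^ K) :=
          mul_le_mul_of_nonneg_left hle (div_nonneg (abs_nonneg c) hD.le)
      _ = |c| := div_mul_cancel₀ _ hD.ne'

/-- **The nested band representation with an algebraic coefficient exists** (`K ≥ 1`):
`[{0 < z₀ < 1, 0 ≤ z₁ ≤ z₀, z₁/z₀ ≤ z₂ ≤ 1}, c·z₀^{A'} z₂^{B'} z₁^D/(1 − z₁^K)]` is an integral
representation for real algebraic `c` — the merged box re-banded by the coordinate permutation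
`(x, y, t) ↦ (x, t, y)`. [cite: KontsevichZagier2001, §1.2 rule (2)] -/
theorem w3_exists_nestedRep {K : ℕ} (hK : 0 < K) (A' B' D : ℕ) {c : ℝ} (hc : IsAlgebraic ℚ c) :
    ∃ R' : IntegralRep 3,
      R'.domain = KZlog.band
        (KZlog.band {y : Fin 1 → ℝ | 0 < y 0 ∧ y 0 < 1} (fun _ => (0:ℝ)) (fun y => y 0))
        (fun w => w 1 / w 0) (fun _ => (1:ℝ)) ∧
      R'.integrand = fun z => c * (z 0 ^ A' * z 2 ^ B' * z 1 ^ D) / (1 - z 1 ^ K) :=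
  ⟨⟨_, _, w3_isSemialgebraic_nestedBand, w3_isSemialgebraicFunOn_nestedIntegrand hK A' B' D hc,
    w3_integrableOn_nestedIntegrand hK A' B' D c⟩, rfl, rfl⟩

/-! ## The base representation on the level-`K` triangle -/

/-- On the triangle `T = {0 < w₀ < 1, 0 ≤ w₁ ≤ w₀}` the level-`K` denominator (`K ≥ 1`) is
positive and controls the numerator of the base integrand: for `E ≤ A'`,
`|w₀^{A'} w₁^D − w₀^{A'−E} w₁^{D+E}| ≤ E(1 − w₁^K)`, since
`w₀^{A'} w₁^D − w₀^{A'−E} w₁^{D+E} = w₀^{A'−E} w₁^D (w₀^E − w₁^E)` with `w₀^{A'−E} w₁^D ∈ [0,1]`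
and `0 ≤ w₀^E − w₁^E ≤ 1 − w₁^E ≤ E(1 − w₁) ≤ E(1 − w₁^K)` (Bernoulli's inequality and
`w₁^K ≤ w₁`). [folklore] -/
theorem w3_base_bounds {K : ℕ} (hK : 0 < K) (A' D E : ℕ) (hEA : E ≤ A') {w : Fin 2 → ℝ}
    (hw : w ∈ KZlog.band {y : Fin 1 → ℝ | 0 < y 0 ∧ y 0 < 1} (fun _ => (0:ℝ)) (fun y => y 0)) :
    0 < 1 - w 1 ^ K ∧
      |w 0 ^ A' * w 1 ^ D - w 0 ^ (A' - E) * w 1 ^ (D + E)| ≤ (E : ℝ) * (1 - w 1 ^ K) := by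
  have h : (0 < w 0 ∧ w 0 < 1) ∧ 0 ≤ w 1 ∧ w 1 ≤ w 0 := hw
  have h0 : 0 ≤ w 0 := h.1.1.le
  have h1 : 0 ≤ w 1 := h.2.1
  have h1' : w 1 < 1 := h.2.2.trans_lt h.1.2
  have hKu : w 1 ^ K ≤ w 1 := pow_le_of_le_one h1 h1'.le hK.ne'
  have hE1 : w 1 ^ E ≤ w 0 ^ E := pow_le_pow_left₀ h1 h.2.2 E
  have hE2 : w 0 ^ E ≤ 1 := pow_le_one₀ h0 h.1.2.le
  have hB : 1 + (E : ℝ) * (w 1 - 1) ≤ w 1 ^ E := one_add_mul_sub_le_pow (by linarith) E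
  have hP0 : 0 ≤ w 0 ^ (A' - E) * w 1 ^ D := mul_nonneg (pow_nonneg h0 _) (pow_nonneg h1 _)
  have hP1 : w 0 ^ (A' - E) * w 1 ^ D ≤ 1 :=
    mul_le_one₀ (pow_le_one₀ h0 h.1.2.le) (pow_nonneg h1 _) (pow_le_one₀ h1 h1'.le)
  have hEK : (E : ℝ) * w 1 ^ K ≤ (E : ℝ) * w 1 := mul_le_mul_of_nonneg_left hKu (Nat.cast_nonneg E)
  have eA : w 0 ^ A' = w 0 ^ (A' - E) * w 0 ^ E := by
    rw [← pow_add, Nat.sub_add_cancel hEA]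
  have e : w 0 ^ A' * w 1 ^ D - w 0 ^ (A' - E) * w 1 ^ (D + E) =
      w 0 ^ (A' - E) * w 1 ^ D * (w 0 ^ E - w 1 ^ E) := by
    rw [eA, pow_add]
    ring
  refine ⟨sub_pos.2 (pow_lt_one₀ h1 h1' hK.ne'), ?_⟩
  rw [e, abs_mul, abs_of_nonneg hP0, abs_of_nonneg (sub_nonneg.2 hE1)]
  calc w 0 ^ (A' - E) * w 1 ^ D * (w 0 ^ E - w 1 ^ E)
      ≤ 1 * (w 0 ^ E - w 1 ^ E) := mul_le_mul_of_nonneg_right hP1 (sub_nonneg.2 hE1)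
    _ ≤ (E : ℝ) * (1 - w 1 ^ K) := by linarith

/-- **Semialgebraicity of the base integrand with an algebraic coefficient.**
`w ↦ (c/E)·(w₀^{A'} w₁^D − w₀^{A'−E} w₁^{D+E})/(1 − w₁^K)` (`K ≥ 1`, truncated subtraction,
`c/0 = 0`) is `ℚ`-semialgebraic on the triangle `T` for real algebraic `c`: the algebraic constant
`c/E` (`isSemialgebraicFunOn_const_of_isAlgebraic`) times a quotient of `ℚ`-polynomials whose
denominator `1 − w₁^K ≥ 1 − w₁ > 0` does not vanish on `T`. [cite: KontsevichZagier2001, §1.1] -/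
theorem w3_isSemialgebraicFunOn_baseIntegrand {K : ℕ} (hK : 0 < K) (A' D E : ℕ) {c : ℝ}
    (hc : IsAlgebraic ℚ c) :
    IsSemialgebraicFunOn ℚ
      (KZlog.band {y : Fin 1 → ℝ | 0 < y 0 ∧ y 0 < 1} (fun _ => (0:ℝ)) (fun y => y 0))
      (fun w => c / (E : ℝ) * (w 0 ^ A' * w 1 ^ D - w 0 ^ (A' - E) * w 1 ^ (D + E)) /
        (1 - w 1 ^ K)) := by
  have hT := LevelOne.isSemialgebraic_triangleBand
  have hcn : IsAlgebraic ℚ (c / (E : ℝ)) := by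
    rw [div_eq_mul_inv]
    exact hc.mul (isAlgebraic_nat E).inv
  refine (IsSemialgebraicFunOn.mul_holds (isSemialgebraicFunOn_const_of_isAlgebraic hT hcn)
    (isSemialgebraicFunOn_aeval_div_aeval hT
      (MvPolynomial.X 0 ^ A' * MvPolynomial.X 1 ^ D -
        MvPolynomial.X 0 ^ (A' - E) * MvPolynomial.X 1 ^ (D + E))
      (1 - MvPolynomial.X 1 ^ K) fun w hw => ?_)).congr fun w _ => ?_
  · have h := LevelK.lk_triangle_denominator_bounds hK hw
    simp only [map_sub, map_one, map_pow, MvPolynomial.aeval_X]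
    exact (h.1.trans_le h.2).ne'
  · simp only [Pi.mul_apply, map_sub, map_one, map_mul, map_pow, MvPolynomial.aeval_X]
    ring

/-- **Absolute convergence of the base integrand with a real coefficient** (`K ≥ 1`, `E ≤ A'`):
`(c/E)·(w₀^{A'} w₁^D − w₀^{A'−E} w₁^{D+E})/(1 − w₁^K)` is integrable on the triangle `T` — it is
measurable and bounded there, `|integrand| ≤ |c/E|·E` (`w3_base_bounds`), and `T ⊆ [0,1]²` has
finite Lebesgue measure. [cite: KontsevichZagier2001, §1.2 rule (3)] -/
theorem w3_integrableOn_baseIntegrand {K : ℕ} (hK : 0 < K) (A' D E : ℕ) (hEA : E ≤ A') (c : ℝ) :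
    IntegrableOn
      (fun w : Fin 2 → ℝ => c / (E : ℝ) * (w 0 ^ A' * w 1 ^ D - w 0 ^ (A' - E) * w 1 ^ (D + E)) /
        (1 - w 1 ^ K))
      (KZlog.band {y : Fin 1 → ℝ | 0 < y 0 ∧ y 0 < 1} (fun _ => (0:ℝ)) (fun y => y 0)) := by
  have hTm : MeasurableSet
      (KZlog.band {y : Fin 1 → ℝ | 0 < y 0 ∧ y 0 < 1} (fun _ => (0:ℝ)) (fun y => y 0)) :=
    IsSemialgebraic.measurableSet_holds LevelOne.isSemialgebraic_triangleBand
  refine Measure.integrableOn_of_bounded (M := |c / (E : ℝ)| * (E : ℝ)) w3_volume_triangle_ne_top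
    (Measurable.aestronglyMeasurable (by fun_prop)) (ae_restrict_of_forall_mem hTm fun w hw => ?_)
  have h := w3_base_bounds hK A' D E hEA hw
  rw [Real.norm_eq_abs, abs_div, abs_mul, abs_of_pos h.1, div_le_iff₀ h.1]
  calc |c / (E : ℝ)| * |w 0 ^ A' * w 1 ^ D - w 0 ^ (A' - E) * w 1 ^ (D + E)|
      ≤ |c / (E : ℝ)| * ((E : ℝ) * (1 - w 1 ^ K)) := mul_le_mul_of_nonneg_left h.2 (abs_nonneg _)
    _ = |c / (E : ℝ)| * (E : ℝ) * (1 - w 1 ^ K) := by ring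

/-- **The base representation on the level-`K` triangle with an algebraic coefficient exists**
(`K ≥ 1`, `E ≤ A'`): `[{0 < w₀ < 1, 0 ≤ w₁ ≤ w₀}, (c/E)·(w₀^{A'} w₁^D − w₀^{A'−E} w₁^{D+E})/(1 − w₁^K)]`
is an integral representation for real algebraic `c` — the result of integrating the nested-band
integrand `c·z₀^{A'} z₂^{E−1} z₁^D/(1 − z₁^K)` out in `z₂ ∈ [z₁/z₀, 1]`.
[cite: KontsevichZagier2001, §1.2 rule (3)] -/
theorem w3_exists_baseRep {K : ℕ} (hK : 0 < K) (A' D E : ℕ) (hEA : E ≤ A') {c : ℝ}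
    (hc : IsAlgebraic ℚ c) :
    ∃ T : IntegralRep 2,
      T.domain = KZlog.band {y : Fin 1 → ℝ | 0 < y 0 ∧ y 0 < 1} (fun _ => (0:ℝ)) (fun y => y 0) ∧
      T.integrand = fun w => c / (E : ℝ) * (w 0 ^ A' * w 1 ^ D - w 0 ^ (A' - E) * w 1 ^ (D + E)) /
        (1 - w 1 ^ K) :=
  ⟨⟨_, _, LevelOne.isSemialgebraic_triangleBand, w3_isSemialgebraicFunOn_baseIntegrand hK A' D E hc,
    w3_integrableOn_baseIntegrand hK A' D E hEA c⟩, rfl, rfl⟩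

/-! ## The registered sub-goal -/

/-- **Stub W6 (existence: the nested band rep and the base rep on the level-`K` triangle;
registered sub-goal `exists_reps3_nested_base` of stmt-KontsevichZagierPeriods-3869).** For
`K ≥ 1` and a real algebraic coefficient `c`, the nested band
`[{0 < z₀ < 1, 0 ≤ z₁ ≤ z₀, z₁/z₀ ≤ z₂ ≤ 1}, c·z₀^{A'} z₂^{B'} z₁^D/(1 − z₁^K)]` (the merged box
`t = xyz` re-banded by `(x, y, t) ↦ (x, t, y)`, rule 2) and, for `E ≤ A'`, the base representation
`[{0 < w₀ < 1, 0 ≤ w₁ ≤ w₀}, (c/E)·(w₀^{A'} w₁^D − w₀^{A'−E} w₁^{D+E})/(1 − w₁^K)]` (the result of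
integrating out the last coordinate, rule 3) exist as integral representations of the
Kontsevich–Zagier calculus, with literally these domains and integrands.
[cite: KontsevichZagier2001, §1.2] -/
theorem exists_reps3_nested_base (K : ℕ) (hK : 0 < K) (c : ℝ) (hc : IsAlgebraic ℚ c) :
    (∀ (A' B' D : ℕ), ∃ R' : IntegralRep 3,
      R'.domain = KZlog.band
        (KZlog.band {y : Fin 1 → ℝ | 0 < y 0 ∧ y 0 < 1} (fun _ => (0:ℝ)) (fun y => y 0))
        (fun w => w 1 / w 0) (fun _ => (1:ℝ)) ∧
      R'.integrand = fun z => c * (z 0 ^ A' * z 2 ^ B' * z 1 ^ D) / (1 - z 1 ^ K)) ∧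
    (∀ (A' D E : ℕ), E ≤ A' → ∃ T : IntegralRep 2,
      T.domain = KZlog.band {y : Fin 1 → ℝ | 0 < y 0 ∧ y 0 < 1} (fun _ => (0:ℝ)) (fun y => y 0) ∧
      T.integrand = fun w => c / (E : ℝ) * (w 0 ^ A' * w 1 ^ D - w 0 ^ (A' - E) * w 1 ^ (D + E)) /
        (1 - w 1 ^ K)) := by
  exact ⟨fun A' B' D => w3_exists_nestedRep hK A' B' D hc,
    fun A' D E hEA => w3_exists_baseRep hK A' D E hEA hc⟩

end Summit.KontsevichZagierPeriods.HurwitzMicroSectors.NormalFormPrinciple.PiBox.Weight3
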